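import Summits.HodgeConjecture.HodgeConjecture.Theorems.Ring2WeilCoverageNormClassEq
import Summits.HodgeConjecture.HodgeConjecture.Theorems.Ring2WeilCoverageNormTableC
import HarnessLib

/-!
# Weil-type family coverage — product windows, part R: ×2 of ring2-b02's `W6.7.13 = (3, ℚ(√-7), [13])` datum on this seat's engine

research route conditional on HC_CM; not a corollary; Q11.4-sentence-2 already refuted in dim ≥ 3.

Ring 2, WEIL-TYPE FAMILY-COVERAGE CENSUS (`HOME/WEIL-FAMILY-COVERAGE.md` `## b04`, block b04.15 P.S. 4, owner ring2-b04, gen 51); eighteenth part of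
`Ring2WeilCoverageProductWindow` (same conventions as parts L–Q).  ring2-b02 (b02.22 P.S. «2026-08-23T21:32:28Z») reached `W6.7.13` with 18 rigid
`PSL₂(7) × S₁₃ / A₁₃` Belyi data of the `(2A, 3A, 7X)` Hurwitz classes of the `η₃`-carrier; this part is the ×2 of their datum
`(2A:2⁶, 3A:3⁴, 7A:(10)(2))` on a DISJOINT engine: carrier `L27c` (`PSL₂(7) = GL₃(2)` on the 7 points of the Fano plane, `λ` the degree-3
character with `ℚ(λ) = ℚ(√-7)`, `H₁ = C₃`, `[G₁:H₁] = 56`), `G₂ = A₁₃` by cycle types, the coset / fibre-product cover `Y = C̃/(H₁ × Stab(0))`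
on `56·13 = 728` sheets (engine `symwin.py` + `bigwin.py`, exact; kit j206637, 54 min): Galois closure of genus 39 852 933 121 (b02: «≥ 3.9·10¹⁰»),
`Y` of genus 49, hidden factor `B` a `(3,3)` WEIL-TYPE sixfold with literal `det H = -13/50176 = -13/(2¹⁰·7²)`, `T = {7, 13}`, class `[13]` —
CONCUR; THEOREM S7 applies (`S_in(PSL₂(7), λ) = ∅`: `3` is inert of defect zero, `2` splits) and predicts `[13]^{r₁}` with `r₁ = 1` ✓.

No `def`, no named fact, no `sorry`; nothing here is a statement about Hodge classes; `HC_CM` is used nowhere.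
References: [cite: vanGeemen1994HodgeAV, (5.4.1), Lemma 5.2]; [cite: Serre1973, Ch. III §1].
-/

set_option linter.dupNamespace false

open Literature.AlgebraicGeometry.Motives
open Literature.AlgebraicGeometry.VanGeemen1994
open Summit.HodgeConjecture.HodgeConjecture.Ring2.Hypotheses

namespace Summit.HodgeConjecture.HodgeConjecture.Ring2.WeilCoverage

/-- FIBRE-PRODUCT datum `L27cxA13` `(0; 2:2^6.1,3:3^4.1,7a:10.2.1)` (cycle types in `A13`; Hurwitz dimension 0; realised by explicit permutations with product one, generation: randomized Schreier-Sims lower bound = 13!/2): `Y = D ×_{ℙ¹} X` (genus 49; `D` the `L27c`-quotient datum = the CM elliptic curve, `X` the degree-13 cover, genus 0), computed on its 728 sheets (engine `bigwin.py`, exact); the HIDDEN FACTOR `B` = the `λ`-part of the Prym `P(Y/D)` — an abelian SIXFOLD with `(3,3)` `ℚ(√-7)`-action, WEIL TYPE — has literal `det H|_B = -13/50176`, `a = 13/50176`, `T(a) = [7, 13]`: row `W6.7.13` (NON-split); `r₁ = dim_K H¹(D)_λ = 1`, `r_H = 7`. THEOREM S8 (Prym form of the product-window law, census b04.15 (A):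 `[a_B] = [n]^{r₁}`, no 2-transitivity needed) predicts `T(a_B) = [7, 13]` from `r₁ = 1`, `n = 13` — CONFIRMED.
research route conditional on HC_CM; not a corollary; Q11.4-sentence-2 already refuted in dim ≥ 3. [cite: vanGeemen1994HodgeAV, (5.4.1)] -/
theorem x2_L27cA13_n13_500aad_mk_detH_ne_split :
    (QuotientGroup.mk (Units.mk0 (((-13 : ℚ) / 50176)) (by norm_num)) : weilNormResidueGroup 7) ≠
      splitDiscriminantClass 3 7 := by
  have e : Units.mk0 (((-13 : ℚ) / 50176)) (by norm_num) = -(Units.mk0 ((13 : ℚ) / 50176) (by norm_num)) := Units.ext (by norm_num)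
  rw [Ne, e, mk_neg_eq_splitDiscriminantClass_iff_of_odd (n := 3) (by decide)]
  have h := mul_not_mem_normUnitsSubgroup (mem_normUnitsSubgroup_of_sq_add_mul_sq (d := 7) (a := ((1 : ℚ) / 50176)) (by norm_num) ((1 : ℚ) / 224) (0 : ℚ) (by norm_num))
    Summit.HodgeConjecture.Ring2WeilNormDescent.thirteen_not_mem_norm_seven
  rw [mk0_mul_mk0] at h
  norm_num at h
  exact h

/-- The same datum, CELL IDENTIFICATION: `[det H|_B] = [-13]` in `ℚˣ/Nm(ℚ(√-7)ˣ)` — the census ROW KEY of `W6.7.13` (`a·13 = ((169 : ℚ) / 50176) = (((13 : ℚ) / 224))² + 7·((0 : ℚ))²`).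
research route conditional on HC_CM; not a corollary; Q11.4-sentence-2 already refuted in dim ≥ 3. [cite: vanGeemen1994HodgeAV, Lemma 5.2 (3)] -/
theorem x2_L27cA13_n13_500aad_mk_detH_eq_key :
    (QuotientGroup.mk (Units.mk0 (-(((13 : ℚ) / 50176))) (neg_ne_zero.2 (by norm_num))) : weilNormResidueGroup 7) =
      QuotientGroup.mk (Units.mk0 (-(13 : ℚ)) (neg_ne_zero.2 (by norm_num))) :=
  mk_neg_eq_mk_neg_of_mul_mem (by norm_num) (by norm_num)
    (mem_normUnitsSubgroup_of_sq_add_mul_sq _ ((13 : ℚ) / 224) (0 : ℚ) (by norm_num))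

end Summit.HodgeConjecture.HodgeConjecture.Ring2.WeilCoverage
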